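import Summits.QuantumFields.YangMills.Theorems.UnitScaleTiltProp7CovariantMorreyBound
import Summits.QuantumFields.YangMills.Theorems.UnitScaleTiltProp7MorreyNormed
import HarnessLib

/-!
# Route `UnitScaleTilt`, crux K1 «MinimiserStabilityRegPr» (stmt-QuantumFields-19200), EX row (5) `h3` (STOREY H), H2 pipeline (ii) — programme **H2-LOC**, brick **(C4c):
# THE INTERIOR `C^{1∕2}` ESTIMATE AT A CURVED BACKGROUND ON `ℤ^d`** — if `u : ℤ^d → W` solves `L_R^κ u = D*_R g + src` on `Q_{4K}(a)` (`K ≥ 3`, `κ > 0`), with `‖u‖ ≤ M_u`,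
# `‖g‖ ≤ m`, `‖src‖ ≤ σ` and the unitary background `δ`-close to `1` (`‖R(y,μ)x − x‖ ≤ δ‖x‖`) on `Q_{4K}(a)`, and `Kδ ≤ θ_d`, then for `x′ ∈ Q_{ρ₀}(a)`, `1 ≤ ρ₀ ≤ K`:
# `‖u(x′) − u(a)‖ ≤ C_d·(M_u + Km + K²σ)·√((2ρ₀+1)∕K)` — the curved twin of lit ✓`B4Eq19LatticeInteriorHolder.exists_interior_holder_const`, UNIFORM IN THE SCALE `K` and in the
# background.  THIS IS THE `ℤ^d` CORE OF THE LETTER `hHlocV` (19200 evidence, text 857ccd79): the torus transfer and the member dictionary are (C5).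

Cell `ym3-torus` (HUMAN RULING D-0037; rung R3 = SU(2) YM₃ on T³ — NOT d = 4, NOT infinite volume, NOT a mass gap, NOT Clay).  Width seat `ym3-torus-px19` (gen 16);
`--supports stmt-QuantumFields-19200 --as helper`; count-neutral; THEOREMS ONLY (0 `def`, 0 `sorry`, default heartbeats).  Inputs BY NAME: (C4b) ✓`Prop7CovariantMorreyBound.morrey_bound_cov`,
(C4a) ✓`Prop7CovariantCampanatoStep.sum_flat_sq_le_cov` ∕ `sum_shift_sq_le_of_bound`, (C3c) ✓p781073 `Prop7MorreyNormed.norm_sub_le_of_morrey` (px21 g16).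

WHAT IS PROVED (ns `Summit.QuantumFields.YangMills.Theorems.Prop7CovariantInteriorHolderZd`; `W` finite-dimensional real inner-product space, `d ≥ 1`; `A_d`, `A₀`, `ε`, `B`, `N₀` as in (C4b)).
* §1 `plain_morrey_of_cov` — at a centre `z` with `Q_{3K}(z) ⊆ Q_{4K}(a)`: the PLAIN bond energy `Σ_{Q_ρ(z)}Σ_μ‖u(y+e_μ) − u(y)‖² ≤ N′·(ρ+1)^{d−1}` for `0 ≤ ρ ≤ 2K`,
  `N′ = 2·C_M·N₀ + 2d·2^d·δ²(2K+1)·M_u²`, `C_M = 2(4(4·2^dA₀))^{2(d−1)}` ((C4b) + the cov→plain conversion).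
* §2 ★★★ `covariant_interior_holder_explicit` — `‖u(x′) − u(a)‖ ≤ 17√(16d·8^d)·√(N′·(2ρ₀+1))` for `x′ ∈ Q_{ρ₀}(a)`, `1 ≤ ρ₀ ≤ K` (px21's ✓`norm_sub_le_of_morrey` at the two centres).
* §3 ★★★ `exists_covariant_interior_holder` — `∃ C θ > 0` (depending on `d` only; `W` fixed) such that under `Kδ ≤ θ` the two smallness conditions of (C4b) hold and
  `‖u(x′) − u(a)‖ ≤ C·(M_u + K·m + K²·σ)·√((2ρ₀+1)∕K)`.
HYP-SAT (★★OWNER RULING №42): one equation + four sup rows on `Q_{4K}(a)` + `Kδ ≤ θ`; inhabited by `u = g = src = 0`, `R ≡ 1`; at the member (C5): `K = ℓ`, `Kδ = 2√2·48ε₀` (pipeline (i)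
✓p780371 + ✓`norm_adBg_sub_self_le`), `Km = M_f`, `K²σ = M_q` — the letter `hHlocV`'s right-hand side `Ch(M_u + M_f + M_q)(tdist∕ℓ)^{½}`.
HONEST SCOPE: [folklore] ([Giaquinta1984] III §1 Thm 1.2 + §2 Thm 2.2 at a perturbed operator); the torus→`ℤ³` transfer and the member currency (C5, px13 g17 first refusal) and the `ω₁` knit
(C6) are NOT here; nothing of `hHlocV` (member form), `hWsup`, H2, `h3`, norm_G, EX, 19200 or the rung is proved; the Yang–Mills mass gap is NOT proved.

References: T. Bałaban, CMP **99** (1985) 389–434 [Balaban1985BackgroundPropagators] (Thm 3.1 (3.43) p.398, (3.35) p.396); CMP **96** (1984) 223–250 [Balaban1984PropagatorsII] ((1.9) p.226);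
M. Giaquinta, *Multiple integrals …* (1983) [Giaquinta1984] (Ch. III §1 Thm 1.2 p.70, §2 Thm 2.2 pp.78–79).
-/

set_option autoImplicit false

noncomputable section

open scoped BigOperators InnerProductSpace
open Finset

namespace Summit.QuantumFields.YangMills.Theorems.Prop7CovariantInteriorHolderZd

open Literature.MathematicalPhysics.QuantumFieldTheory.Balaban1983to89
open B4Eq19LatticeOperators (Zd unitVec box mem_box box_mono box_subset_box self_mem_box add_unitVec_mem_box card_box)
open Summit.QuantumFields.YangMills.Theorems.Prop7CovariantCampanatoStep (sum_flat_sq_le_cov sum_shift_sq_le_of_bound)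
open Summit.QuantumFields.YangMills.Theorems.Prop7CovariantMorreyBound (morrey_bound_cov one_le_Ad)
open Summit.QuantumFields.YangMills.Theorems.Prop7MorreyNormed (norm_sub_le_of_morrey)

variable {d : ℕ} {W : Type*} [NormedAddCommGroup W] [InnerProductSpace ℝ W] [FiniteDimensional ℝ W]

/-! ## §1 The plain Morrey decay at a centre of `Q_K(a)` -/

/-- **PLAIN MORREY DECAY AT A CENTRE.**  Under (C4b)'s hypotheses on `Q_{4K}(a)` and for a centre `z ∈ Q_K(a)`: for `0 ≤ ρ ≤ 2K`,
`Σ_{Q_ρ(z)}Σ_μ‖u(y+e_μ) − u(y)‖² ≤ (2·C_M·N₀ + 2d·2^d·δ²(2K+1)·M_u²)·(ρ+1)^{d−1}` (covariant Morrey bound (C4b) at `z` — `Q_{3K}(z) ⊆ Q_{4K}(a)` — then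
`plain ≤ 2·cov + 2δ²ΣΣ‖u₊‖²` and `(2ρ+1)^d ≤ 2^d(2K+1)(ρ+1)^{d−1}`). [folklore] [cite: Giaquinta1984, Ch. III §2 Thm 2.2 p.78; Balaban1985BackgroundPropagators, (3.35) p.396] -/
theorem plain_morrey_of_cov (hd : 1 ≤ d) (R : Zd d → Fin d → (W ≃ₗᵢ[ℝ] W)) {κ : ℝ} (hκ : 0 < κ)
    (u : Zd d → W) (g : Zd d → Fin d → W) (src : Zd d → W) (a : Zd d) {K : ℕ} (hK : 3 ≤ K)
    {Mu m σ δ : ℝ} (hMu : 0 ≤ Mu) (hm : 0 ≤ m) (hσ : 0 ≤ σ) (hδ : 0 ≤ δ)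
    (hEq : ∀ y ∈ box a (4 * (K : ℤ)),
      (∑ μ, ((2 : ℝ) • u y - R y μ (u (y + unitVec μ)) - (R (y - unitVec μ) μ).symm (u (y - unitVec μ)))) + κ • u y
        = (∑ μ, ((R (y - unitVec μ) μ).symm (g (y - unitVec μ) μ) - g y μ)) + src y)
    (hu : ∀ y ∈ box a (4 * (K : ℤ)), ‖u y‖ ≤ Mu)
    (hg : ∀ y ∈ box a (4 * (K : ℤ)), ∀ μ, ‖g y μ‖ ≤ m)
    (hs : ∀ y ∈ box a (4 * (K : ℤ)), ‖src y‖ ≤ σ)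
    (hR : ∀ y ∈ box a (4 * (K : ℤ)), ∀ (μ : Fin d) (x : W), ‖R y μ x - x‖ ≤ δ * ‖x‖)
    (hsmall : (d : ℝ) * δ ^ 2 * (4 * (K : ℝ)) ^ 2 ≤ 1)
    (hslack : ((8 * ((2 : ℝ) ^ d * (1 + 56 * d) ^ d * (8 * ((d : ℝ) + 1)) ^ (d + 1)) + 4) * (5 * d * δ ^ 2 * (4 * (K : ℝ)) ^ 2))
        * (4 * (4 * (2 : ℝ) ^ d * (4 * (3 : ℝ) ^ d * ((2 : ℝ) ^ d * (1 + 56 * d) ^ d * (8 * ((d : ℝ) + 1)) ^ (d + 1))))) ^ d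
      ≤ 4 * (2 : ℝ) ^ d * (4 * (3 : ℝ) ^ d * ((2 : ℝ) ^ d * (1 + 56 * d) ^ d * (8 * ((d : ℝ) + 1)) ^ (d + 1))))
    (z : Zd d) (hz : z ∈ box a (K : ℤ)) :
    ∀ ρ : ℤ, 0 ≤ ρ → ρ ≤ 2 * (K : ℤ) →
      ∑ y ∈ box z ρ, ∑ μ, ‖u (y + unitVec μ) - u y‖ ^ 2 ≤
        (2 * (2 * (4 * (4 * (2 : ℝ) ^ d * (4 * (3 : ℝ) ^ d * ((2 : ℝ) ^ d * (1 + 56 * d) ^ d * (8 * ((d : ℝ) + 1)) ^ (d + 1))))) ^ (2 * (d - 1))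
            * (126 * d * (7 : ℝ) ^ d * Mu ^ 2 / (K : ℝ)
              + (4 * d * (6 : ℝ) ^ d * m ^ 2 + 2 * (6 : ℝ) ^ d * (Mu * σ)
                 + (3 : ℝ) ^ d * ((2 : ℝ) ^ d * ((8 * ((2 : ℝ) ^ d * (1 + 56 * d) ^ d * (8 * ((d : ℝ) + 1)) ^ (d + 1)) + 4) * (5 * (4 * d * m ^ 2 + (4 * (K : ℝ)) ^ 2 * σ ^ 2 + 5 * d * δ ^ 2 * Mu ^ 2))
                    + (16 * ((2 : ℝ) ^ d * (1 + 56 * d) ^ d * (8 * ((d : ℝ) + 1)) ^ (d + 1)) + 2) * (d * δ ^ 2 * Mu ^ 2)))) * (K : ℝ)))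
          + 2 * d * (2 : ℝ) ^ d * (δ ^ 2 * (2 * (K : ℝ) + 1)) * Mu ^ 2) * ((ρ : ℝ) + 1) ^ (d - 1) := by
  intro ρ hρ hρK
  have hKZ : (3 : ℤ) ≤ K := by exact_mod_cast hK
  have hKR : (3 : ℝ) ≤ K := by exact_mod_cast hK
  have hd0 : (0 : ℝ) ≤ d := Nat.cast_nonneg d
  have hρR : (0 : ℝ) ≤ ρ := by exact_mod_cast hρ
  have hρKR : (ρ : ℝ) ≤ 2 * K := by exact_mod_cast hρK
  -- `Q_{3K}(z) ⊆ Q_{4K}(a)`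
  have hz' := mem_box.1 hz
  have hsub3 : box z (3 * (K : ℤ)) ⊆ box a (4 * (K : ℤ)) := box_subset_box fun i => by have := hz' i; linarith
  -- the covariant Morrey bound at `z`
  have hcov := morrey_bound_cov hd R hκ u g src z hK hMu hm hσ hδ (fun y hy => hEq y (hsub3 hy)) (fun y hy => hu y (hsub3 hy))
    (fun y hy => hg y (hsub3 hy)) (fun y hy => hs y (hsub3 hy)) (fun y hy => hR y (hsub3 hy)) hsmall hslack ρ hρ hρK
  -- plain ≤ 2 cov + 2 δ² shifted mass
  have hsubρ : box z ρ ⊆ box a (4 * (K : ℤ)) := (box_mono z (by linarith)).trans hsub3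
  have hconv := sum_flat_sq_le_cov R u (box z ρ) (δ := δ) (fun y hy => hR y (hsubρ hy))
  have hS : ∑ y ∈ box z ρ, ∑ μ, ‖u (y + unitVec μ)‖ ^ 2 ≤ d * ((2 * ρ + 1 : ℤ) : ℝ) ^ d * Mu ^ 2 :=
    sum_shift_sq_le_of_bound u z hρ (fun y hy => hu y (((box_mono z (by linarith)).trans hsub3) hy))
  -- `(2ρ+1)^d ≤ 2^d (2K+1) (ρ+1)^{d-1}`
  have hpow : ((2 * ρ + 1 : ℤ) : ℝ) ^ d ≤ (2 : ℝ) ^ d * (2 * (K : ℝ) + 1) * ((ρ : ℝ) + 1) ^ (d - 1) := by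
    have e : ((2 * ρ + 1 : ℤ) : ℝ) ^ d = ((2 * ρ + 1 : ℤ) : ℝ) ^ (d - 1) * ((2 * ρ + 1 : ℤ) : ℝ) := by rw [← pow_succ]; congr 1; omega
    have h1 : ((2 * ρ + 1 : ℤ) : ℝ) ^ (d - 1) ≤ (2 * ((ρ : ℝ) + 1)) ^ (d - 1) := pow_le_pow_left₀ (by push_cast; linarith) (by push_cast; linarith) _
    have h2 : ((2 * ρ + 1 : ℤ) : ℝ) ≤ 2 * (2 * (K : ℝ) + 1) := by push_cast; linarith
    have h3 : (2 : ℝ) ^ (d - 1) ≤ (2 : ℝ) ^ d / 2 := by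
      rw [le_div_iff₀ (by norm_num : (0:ℝ) < 2), ← pow_succ]; apply le_of_eq; congr 1; omega
    rw [e, mul_pow] at *
    have h4 : 0 ≤ ((ρ : ℝ) + 1) ^ (d - 1) := by positivity
    calc ((2 * ρ + 1 : ℤ) : ℝ) ^ (d - 1) * ((2 * ρ + 1 : ℤ) : ℝ) ≤ ((2 : ℝ) ^ (d - 1) * ((ρ : ℝ) + 1) ^ (d - 1)) * (2 * (2 * (K : ℝ) + 1)) :=
          mul_le_mul h1 h2 (by push_cast; linarith) (by positivity)
      _ ≤ ((2 : ℝ) ^ d / 2 * ((ρ : ℝ) + 1) ^ (d - 1)) * (2 * (2 * (K : ℝ) + 1)) := by gcongr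
      _ = (2 : ℝ) ^ d * (2 * (K : ℝ) + 1) * ((ρ : ℝ) + 1) ^ (d - 1) := by ring
  have hδS : δ ^ 2 * ∑ y ∈ box z ρ, ∑ μ, ‖u (y + unitVec μ)‖ ^ 2 ≤ d * (2 : ℝ) ^ d * (δ ^ 2 * (2 * (K : ℝ) + 1)) * Mu ^ 2 * ((ρ : ℝ) + 1) ^ (d - 1) := by
    have h1 := mul_le_mul_of_nonneg_left hS (sq_nonneg δ)
    have h2 := mul_le_mul_of_nonneg_left hpow (by positivity : 0 ≤ δ ^ 2 * (d * Mu ^ 2))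
    calc δ ^ 2 * ∑ y ∈ box z ρ, ∑ μ, ‖u (y + unitVec μ)‖ ^ 2 ≤ δ ^ 2 * (d * ((2 * ρ + 1 : ℤ) : ℝ) ^ d * Mu ^ 2) := h1
      _ = δ ^ 2 * (d * Mu ^ 2) * ((2 * ρ + 1 : ℤ) : ℝ) ^ d := by ring
      _ ≤ δ ^ 2 * (d * Mu ^ 2) * ((2 : ℝ) ^ d * (2 * (K : ℝ) + 1) * ((ρ : ℝ) + 1) ^ (d - 1)) := h2
      _ = d * (2 : ℝ) ^ d * (δ ^ 2 * (2 * (K : ℝ) + 1)) * Mu ^ 2 * ((ρ : ℝ) + 1) ^ (d - 1) := by ring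
  linarith [hconv, hcov, hδS]

/-! ## §2 ★★★ The explicit interior estimate -/

/-- ★★★ **THE INTERIOR `C^{1∕2}` ESTIMATE AT A CURVED BACKGROUND, EXPLICIT CONSTANTS**: under (C4b)'s hypotheses on `Q_{4K}(a)` (`K ≥ 3`), for `x′ ∈ Q_{ρ₀}(a)`, `1 ≤ ρ₀ ≤ K`:
`‖u(x′) − u(a)‖ ≤ 17√(16d·8^d)·√(N′·(2ρ₀+1))` with §1's `N′` (px21 g16's ✓`norm_sub_le_of_morrey` at the centres `a` and `x′`, `R₀ = 2K`).
[folklore] [cite: Giaquinta1984, Ch. III §1 Thm 1.2 p.70, §2 Thm 2.2 p.78; Balaban1985BackgroundPropagators, Thm 3.1 (3.43) p.398] -/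
theorem covariant_interior_holder_explicit (hd : 1 ≤ d) (R : Zd d → Fin d → (W ≃ₗᵢ[ℝ] W)) {κ : ℝ} (hκ : 0 < κ)
    (u : Zd d → W) (g : Zd d → Fin d → W) (src : Zd d → W) (a : Zd d) {K : ℕ} (hK : 3 ≤ K)
    {Mu m σ δ : ℝ} (hMu : 0 ≤ Mu) (hm : 0 ≤ m) (hσ : 0 ≤ σ) (hδ : 0 ≤ δ)
    (hEq : ∀ y ∈ box a (4 * (K : ℤ)),
      (∑ μ, ((2 : ℝ) • u y - R y μ (u (y + unitVec μ)) - (R (y - unitVec μ) μ).symm (u (y - unitVec μ)))) + κ • u y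
        = (∑ μ, ((R (y - unitVec μ) μ).symm (g (y - unitVec μ) μ) - g y μ)) + src y)
    (hu : ∀ y ∈ box a (4 * (K : ℤ)), ‖u y‖ ≤ Mu)
    (hg : ∀ y ∈ box a (4 * (K : ℤ)), ∀ μ, ‖g y μ‖ ≤ m)
    (hs : ∀ y ∈ box a (4 * (K : ℤ)), ‖src y‖ ≤ σ)
    (hR : ∀ y ∈ box a (4 * (K : ℤ)), ∀ (μ : Fin d) (x : W), ‖R y μ x - x‖ ≤ δ * ‖x‖)
    (hsmall : (d : ℝ) * δ ^ 2 * (4 * (K : ℝ)) ^ 2 ≤ 1)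
    (hslack : ((8 * ((2 : ℝ) ^ d * (1 + 56 * d) ^ d * (8 * ((d : ℝ) + 1)) ^ (d + 1)) + 4) * (5 * d * δ ^ 2 * (4 * (K : ℝ)) ^ 2))
        * (4 * (4 * (2 : ℝ) ^ d * (4 * (3 : ℝ) ^ d * ((2 : ℝ) ^ d * (1 + 56 * d) ^ d * (8 * ((d : ℝ) + 1)) ^ (d + 1))))) ^ d
      ≤ 4 * (2 : ℝ) ^ d * (4 * (3 : ℝ) ^ d * ((2 : ℝ) ^ d * (1 + 56 * d) ^ d * (8 * ((d : ℝ) + 1)) ^ (d + 1))))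
    {ρ₀ : ℕ} (hρ₀ : 1 ≤ ρ₀) (hρ₀K : ρ₀ ≤ K) {x' : Zd d} (hx' : x' ∈ box a (ρ₀ : ℤ)) :
    ‖u x' - u a‖ ≤ 17 * Real.sqrt (16 * d * 8 ^ d) * Real.sqrt (
        (2 * (2 * (4 * (4 * (2 : ℝ) ^ d * (4 * (3 : ℝ) ^ d * ((2 : ℝ) ^ d * (1 + 56 * d) ^ d * (8 * ((d : ℝ) + 1)) ^ (d + 1))))) ^ (2 * (d - 1))
            * (126 * d * (7 : ℝ) ^ d * Mu ^ 2 / (K : ℝ)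
              + (4 * d * (6 : ℝ) ^ d * m ^ 2 + 2 * (6 : ℝ) ^ d * (Mu * σ)
                 + (3 : ℝ) ^ d * ((2 : ℝ) ^ d * ((8 * ((2 : ℝ) ^ d * (1 + 56 * d) ^ d * (8 * ((d : ℝ) + 1)) ^ (d + 1)) + 4) * (5 * (4 * d * m ^ 2 + (4 * (K : ℝ)) ^ 2 * σ ^ 2 + 5 * d * δ ^ 2 * Mu ^ 2))
                    + (16 * ((2 : ℝ) ^ d * (1 + 56 * d) ^ d * (8 * ((d : ℝ) + 1)) ^ (d + 1)) + 2) * (d * δ ^ 2 * Mu ^ 2)))) * (K : ℝ)))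
          + 2 * d * (2 : ℝ) ^ d * (δ ^ 2 * (2 * (K : ℝ) + 1)) * Mu ^ 2) * (2 * (ρ₀ : ℝ) + 1)) := by
  have hKZ : (ρ₀ : ℤ) ≤ K := by exact_mod_cast hρ₀K
  have ha : a ∈ box a (K : ℤ) := self_mem_box a (by positivity)
  have hxK : x' ∈ box a (K : ℤ) := box_mono a hKZ hx'
  have hN0 : 0 ≤ (2 * (2 * (4 * (4 * (2 : ℝ) ^ d * (4 * (3 : ℝ) ^ d * ((2 : ℝ) ^ d * (1 + 56 * d) ^ d * (8 * ((d : ℝ) + 1)) ^ (d + 1))))) ^ (2 * (d - 1))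
            * (126 * d * (7 : ℝ) ^ d * Mu ^ 2 / (K : ℝ)
              + (4 * d * (6 : ℝ) ^ d * m ^ 2 + 2 * (6 : ℝ) ^ d * (Mu * σ)
                 + (3 : ℝ) ^ d * ((2 : ℝ) ^ d * ((8 * ((2 : ℝ) ^ d * (1 + 56 * d) ^ d * (8 * ((d : ℝ) + 1)) ^ (d + 1)) + 4) * (5 * (4 * d * m ^ 2 + (4 * (K : ℝ)) ^ 2 * σ ^ 2 + 5 * d * δ ^ 2 * Mu ^ 2))
                    + (16 * ((2 : ℝ) ^ d * (1 + 56 * d) ^ d * (8 * ((d : ℝ) + 1)) ^ (d + 1)) + 2) * (d * δ ^ 2 * Mu ^ 2)))) * (K : ℝ)))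
          + 2 * d * (2 : ℝ) ^ d * (δ ^ 2 * (2 * (K : ℝ) + 1)) * Mu ^ 2) := by
    have hd0 : (0 : ℝ) ≤ d := Nat.cast_nonneg d
    positivity
  exact norm_sub_le_of_morrey hd u hρ₀ hx' hN0 (R₀ := 2 * (K : ℤ)) (by linarith)
    (plain_morrey_of_cov hd R hκ u g src a hK hMu hm hσ hδ hEq hu hg hs hR hsmall hslack a ha)
    (plain_morrey_of_cov hd R hκ u g src a hK hMu hm hσ hδ hEq hu hg hs hR hsmall hslack x' hxK)

/-! ## §3 ★★★ The estimate with one smallness letter `Kδ ≤ θ_d` and one constant -/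

omit [FiniteDimensional ℝ W] [InnerProductSpace ℝ W] [NormedAddCommGroup W] in
/-- The bookkeeping behind §3: with `S := M_u + Km + K²σ` and `Kδ ≤ 1`, the Morrey constant `N′` of §1 satisfies `N′ ≤ C₁·S²∕K`,
`C₁ = 2C_M(126d7^d + 4d6^d + 2·6^d + 3^d2^d((8A+4)·5·(9d+16) + (16A+2)d)) + 6d2^d` (monotone substitution `M_u ≤ S`, `m ≤ S∕K`, `σ ≤ S∕K²`, `δ ≤ 1∕K`, `2K+1 ≤ 3K`).
[folklore] [cite: Giaquinta1984, Ch. III §2 Thm 2.2 p.79] -/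
theorem morrey_constant_le {A CM Mu m σ δ : ℝ} {K : ℕ} (hA8 : 0 ≤ 8 * A + 4) (hA16 : 0 ≤ 16 * A + 2) (hCM0 : 0 ≤ CM)
    (hMu : 0 ≤ Mu) (hm : 0 ≤ m) (hσ : 0 ≤ σ) (hδ : 0 ≤ δ) (hK0 : (0 : ℝ) < K) (hKδ1 : (K : ℝ) * δ ≤ 1) :
    2 * (CM * (126 * d * (7 : ℝ) ^ d * Mu ^ 2 / (K : ℝ)
              + (4 * d * (6 : ℝ) ^ d * m ^ 2 + 2 * (6 : ℝ) ^ d * (Mu * σ)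
                 + (3 : ℝ) ^ d * ((2 : ℝ) ^ d * ((8 * A + 4) * (5 * (4 * d * m ^ 2 + (4 * (K : ℝ)) ^ 2 * σ ^ 2 + 5 * d * δ ^ 2 * Mu ^ 2))
                    + (16 * A + 2) * (d * δ ^ 2 * Mu ^ 2)))) * (K : ℝ)))
          + 2 * d * (2 : ℝ) ^ d * (δ ^ 2 * (2 * (K : ℝ) + 1)) * Mu ^ 2
      ≤ (2 * CM * (126 * d * (7 : ℝ) ^ d + 4 * d * (6 : ℝ) ^ d + 2 * (6 : ℝ) ^ d
          + (3 : ℝ) ^ d * ((2 : ℝ) ^ d * ((8 * A + 4) * (5 * (4 * d + 16 + 5 * d)) + (16 * A + 2) * d))) + 6 * d * (2 : ℝ) ^ d)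
        * (Mu + (K : ℝ) * m + (K : ℝ) ^ 2 * σ) ^ 2 / K := by
  have hd0 : (0 : ℝ) ≤ d := Nat.cast_nonneg d
  set S : ℝ := Mu + (K : ℝ) * m + (K : ℝ) ^ 2 * σ with hS
  have hKm0 : 0 ≤ (K : ℝ) * m := mul_nonneg hK0.le hm
  have hKσ0 : 0 ≤ (K : ℝ) ^ 2 * σ := mul_nonneg (sq_nonneg _) hσ
  have hS0 : 0 ≤ S := by simp only [hS]; linarith
  have hMuS : Mu ≤ S := by simp only [hS]; linarith
  have hmS : m ≤ S / K := by
    rw [le_div_iff₀ hK0]; simp only [hS]; linarith [show m * (K : ℝ) = (K : ℝ) * m by ring]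
  have hσS : σ ≤ S / (K : ℝ) ^ 2 := by
    rw [le_div_iff₀ (by positivity)]; simp only [hS]; linarith [show σ * (K : ℝ) ^ 2 = (K : ℝ) ^ 2 * σ by ring]
  have hδK : δ ≤ 1 / K := by rw [le_div_iff₀ hK0, mul_comm]; exact hKδ1
  have h2K : 2 * (K : ℝ) + 1 ≤ 3 * K := by
    have hK1 : (1 : ℝ) ≤ K := by exact_mod_cast (Nat.cast_pos.mp hK0)
    linarith
  have hsubB : (8 * A + 4) * (5 * (4 * d * m ^ 2 + (4 * (K : ℝ)) ^ 2 * σ ^ 2 + 5 * d * δ ^ 2 * Mu ^ 2)) + (16 * A + 2) * (d * δ ^ 2 * Mu ^ 2)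
      ≤ (8 * A + 4) * (5 * (4 * d * (S / K) ^ 2 + (4 * (K : ℝ)) ^ 2 * (S / (K : ℝ) ^ 2) ^ 2 + 5 * d * (1 / K) ^ 2 * S ^ 2)) + (16 * A + 2) * (d * (1 / K) ^ 2 * S ^ 2) := by
    gcongr
  have t1 : 126 * d * (7 : ℝ) ^ d * Mu ^ 2 / (K : ℝ) ≤ 126 * d * (7 : ℝ) ^ d * S ^ 2 / (K : ℝ) := by gcongr
  have t2 : 4 * d * (6 : ℝ) ^ d * m ^ 2 ≤ 4 * d * (6 : ℝ) ^ d * (S / K) ^ 2 := by gcongr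
  have t3 : 2 * (6 : ℝ) ^ d * (Mu * σ) ≤ 2 * (6 : ℝ) ^ d * (S * (S / (K : ℝ) ^ 2)) := by gcongr
  have t4 : (3 : ℝ) ^ d * ((2 : ℝ) ^ d * ((8 * A + 4) * (5 * (4 * d * m ^ 2 + (4 * (K : ℝ)) ^ 2 * σ ^ 2 + 5 * d * δ ^ 2 * Mu ^ 2)) + (16 * A + 2) * (d * δ ^ 2 * Mu ^ 2)))
      ≤ (3 : ℝ) ^ d * ((2 : ℝ) ^ d * ((8 * A + 4) * (5 * (4 * d * (S / K) ^ 2 + (4 * (K : ℝ)) ^ 2 * (S / (K : ℝ) ^ 2) ^ 2 + 5 * d * (1 / K) ^ 2 * S ^ 2)) + (16 * A + 2) * (d * (1 / K) ^ 2 * S ^ 2))) :=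
    mul_le_mul_of_nonneg_left (mul_le_mul_of_nonneg_left hsubB (by positivity)) (by positivity)
  have hsubN : 126 * d * (7 : ℝ) ^ d * Mu ^ 2 / (K : ℝ)
        + (4 * d * (6 : ℝ) ^ d * m ^ 2 + 2 * (6 : ℝ) ^ d * (Mu * σ)
           + (3 : ℝ) ^ d * ((2 : ℝ) ^ d * ((8 * A + 4) * (5 * (4 * d * m ^ 2 + (4 * (K : ℝ)) ^ 2 * σ ^ 2 + 5 * d * δ ^ 2 * Mu ^ 2))
              + (16 * A + 2) * (d * δ ^ 2 * Mu ^ 2)))) * (K : ℝ)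
      ≤ 126 * d * (7 : ℝ) ^ d * S ^ 2 / (K : ℝ)
        + (4 * d * (6 : ℝ) ^ d * (S / K) ^ 2 + 2 * (6 : ℝ) ^ d * (S * (S / (K : ℝ) ^ 2))
           + (3 : ℝ) ^ d * ((2 : ℝ) ^ d * ((8 * A + 4) * (5 * (4 * d * (S / K) ^ 2 + (4 * (K : ℝ)) ^ 2 * (S / (K : ℝ) ^ 2) ^ 2 + 5 * d * (1 / K) ^ 2 * S ^ 2))
              + (16 * A + 2) * (d * (1 / K) ^ 2 * S ^ 2)))) * (K : ℝ) :=
    add_le_add t1 (mul_le_mul_of_nonneg_right (add_le_add (add_le_add t2 t3) t4) hK0.le)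
  have hsubT : 2 * d * (2 : ℝ) ^ d * (δ ^ 2 * (2 * (K : ℝ) + 1)) * Mu ^ 2 ≤ 2 * d * (2 : ℝ) ^ d * ((1 / K) ^ 2 * (3 * (K : ℝ))) * S ^ 2 := by
    gcongr
  have hident : 2 * (CM * (126 * d * (7 : ℝ) ^ d * S ^ 2 / (K : ℝ)
              + (4 * d * (6 : ℝ) ^ d * (S / K) ^ 2 + 2 * (6 : ℝ) ^ d * (S * (S / (K : ℝ) ^ 2))
                 + (3 : ℝ) ^ d * ((2 : ℝ) ^ d * ((8 * A + 4) * (5 * (4 * d * (S / K) ^ 2 + (4 * (K : ℝ)) ^ 2 * (S / (K : ℝ) ^ 2) ^ 2 + 5 * d * (1 / K) ^ 2 * S ^ 2))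
                    + (16 * A + 2) * (d * (1 / K) ^ 2 * S ^ 2)))) * (K : ℝ)))
          + 2 * d * (2 : ℝ) ^ d * ((1 / K) ^ 2 * (3 * (K : ℝ))) * S ^ 2
      = (2 * CM * (126 * d * (7 : ℝ) ^ d + 4 * d * (6 : ℝ) ^ d + 2 * (6 : ℝ) ^ d
          + (3 : ℝ) ^ d * ((2 : ℝ) ^ d * ((8 * A + 4) * (5 * (4 * d + 16 + 5 * d)) + (16 * A + 2) * d))) + 6 * d * (2 : ℝ) ^ d) * S ^ 2 / K := by
    field_simp; ring
  have h1 := mul_le_mul_of_nonneg_left hsubN hCM0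
  rw [← hident]
  linarith

/-- ★★★ **THE INTERIOR `C^{1∕2}` ESTIMATE AT A CURVED BACKGROUND ON `ℤ^d`** (the `ℤ^d` core of `hHlocV`).  There are `C, θ > 0`, depending on the dimension `d` only (the fibre `W` being
fixed), such that: for every unitary background `R`, every `κ > 0`, `K ≥ 3`, every `u, g, src`, centre `a` and letters `M_u, m, σ, δ ≥ 0` with `K·δ ≤ θ`, if
`L_R^κ u = D*_R g + src` holds on `Q_{4K}(a)` and `‖u‖ ≤ M_u`, `‖g‖ ≤ m`, `‖src‖ ≤ σ`, `‖R(y,μ)x − x‖ ≤ δ‖x‖` there, then for `1 ≤ ρ₀ ≤ K` and `x′ ∈ Q_{ρ₀}(a)`: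
`‖u(x′) − u(a)‖ ≤ C·(M_u + K·m + K²·σ)·√((2ρ₀+1)∕K)` — UNIFORM IN THE SCALE `K` AND IN THE BACKGROUND.  (`θ := 1∕(1 + 16d + Λ_d)` discharges (C4b)'s two smallness
conditions; `N′·K ≤ C₁·(M_u + Km + K²σ)²` by monotone substitution `m ≤ S∕K`, `σ ≤ S∕K²`, `δ ≤ 1∕K`, `M_u ≤ S`.)
[folklore] [cite: Giaquinta1984, Ch. III §1 Thm 1.2 p.70, §2 Thm 2.2 pp.78–79; Balaban1985BackgroundPropagators, Thm 3.1 (3.43) p.398, (3.35) p.396; Balaban1984PropagatorsII, (1.9) p.226] -/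
theorem exists_covariant_interior_holder (hd : 1 ≤ d) : ∃ C θ : ℝ, 0 ≤ C ∧ 0 < θ ∧
    ∀ (R : Zd d → Fin d → (W ≃ₗᵢ[ℝ] W)) (κ : ℝ), 0 < κ → ∀ (u : Zd d → W) (g : Zd d → Fin d → W) (src : Zd d → W) (a : Zd d) (K : ℕ), 3 ≤ K →
    ∀ (Mu m σ δ : ℝ), 0 ≤ Mu → 0 ≤ m → 0 ≤ σ → 0 ≤ δ → (K : ℝ) * δ ≤ θ →
    (∀ y ∈ box a (4 * (K : ℤ)),
      (∑ μ, ((2 : ℝ) • u y - R y μ (u (y + unitVec μ)) - (R (y - unitVec μ) μ).symm (u (y - unitVec μ)))) + κ • u y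
        = (∑ μ, ((R (y - unitVec μ) μ).symm (g (y - unitVec μ) μ) - g y μ)) + src y) →
    (∀ y ∈ box a (4 * (K : ℤ)), ‖u y‖ ≤ Mu) → (∀ y ∈ box a (4 * (K : ℤ)), ∀ μ, ‖g y μ‖ ≤ m) → (∀ y ∈ box a (4 * (K : ℤ)), ‖src y‖ ≤ σ) →
    (∀ y ∈ box a (4 * (K : ℤ)), ∀ (μ : Fin d) (x : W), ‖R y μ x - x‖ ≤ δ * ‖x‖) →
    ∀ (ρ₀ : ℕ), 1 ≤ ρ₀ → ρ₀ ≤ K → ∀ x' ∈ box a (ρ₀ : ℤ),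
      ‖u x' - u a‖ ≤ C * (Mu + (K : ℝ) * m + (K : ℝ) ^ 2 * σ) * Real.sqrt ((2 * (ρ₀ : ℝ) + 1) / (K : ℝ)) := by
  have hd0 : (0 : ℝ) ≤ d := Nat.cast_nonneg d
  -- the constants of (C4b)
  set A : ℝ := (2 : ℝ) ^ d * (1 + 56 * d) ^ d * (8 * ((d : ℝ) + 1)) ^ (d + 1) with hA
  have hA1 : 1 ≤ A := by rw [hA]; exact one_le_Ad
  set A₀ : ℝ := 4 * (3 : ℝ) ^ d * A with hA₀
  have hA₀1 : 1 ≤ A₀ := by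
    rw [hA₀]
    have h3 : (1 : ℝ) ≤ (3 : ℝ) ^ d := one_le_pow₀ (by norm_num)
    calc (1 : ℝ) ≤ 4 * 1 * 1 := by norm_num
      _ ≤ 4 * (3 : ℝ) ^ d * A := by gcongr
  set Λ : ℝ := (8 * A + 4) * (80 * d) * (4 * (4 * (2 : ℝ) ^ d * A₀)) ^ d with hΛ
  have hΛ0 : 0 ≤ Λ := by rw [hΛ]; positivity
  set θ : ℝ := 1 / (1 + 16 * d + Λ) with hθ
  have hden : 0 < 1 + 16 * (d : ℝ) + Λ := by positivity
  have hθ0 : 0 < θ := by rw [hθ]; positivity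
  have hθ1 : θ ≤ 1 := by rw [hθ, div_le_one hden]; linarith
  set CM : ℝ := 2 * (4 * (4 * (2 : ℝ) ^ d * A₀)) ^ (2 * (d - 1)) with hCM
  have hCM0 : 0 ≤ CM := by rw [hCM]; positivity
  set C₁ : ℝ := 2 * CM * (126 * d * (7 : ℝ) ^ d + 4 * d * (6 : ℝ) ^ d + 2 * (6 : ℝ) ^ d
      + (3 : ℝ) ^ d * ((2 : ℝ) ^ d * ((8 * A + 4) * (5 * (4 * d + 16 + 5 * d)) + (16 * A + 2) * d))) + 6 * d * (2 : ℝ) ^ d with hC₁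
  have hC₁0 : 0 ≤ C₁ := by rw [hC₁]; positivity
  refine ⟨17 * Real.sqrt (16 * d * 8 ^ d) * Real.sqrt C₁, θ, by positivity, hθ0, ?_⟩
  intro R κ hκ u g src a K hK Mu m σ δ hMu hm hσ hδ hKδ hEq hu hg hs hR ρ₀ hρ₀ hρ₀K x' hx'
  have hK3 : (3 : ℝ) ≤ K := by exact_mod_cast hK
  have hK0 : (0 : ℝ) < K := by linarith
  -- `(Kδ)² ≤ θ`
  have hKδ0 : 0 ≤ (K : ℝ) * δ := by positivity
  have hKδ2 : ((K : ℝ) * δ) ^ 2 ≤ θ := by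
    calc ((K : ℝ) * δ) ^ 2 ≤ θ ^ 2 := pow_le_pow_left₀ hKδ0 hKδ _
      _ = θ * θ := sq θ
      _ ≤ θ * 1 := mul_le_mul_of_nonneg_left hθ1 hθ0.le
      _ = θ := mul_one θ
  have hθd : θ * (1 + 16 * d + Λ) = 1 := by rw [hθ]; field_simp
  -- the two smallness conditions of (C4b)
  have h16 : 16 * (d : ℝ) * θ ≤ 1 := by
    have := mul_le_mul_of_nonneg_left (show 16 * (d : ℝ) ≤ 1 + 16 * d + Λ by linarith) hθ0.le
    linarith [this, hθd]
  have hΛθ : Λ * θ ≤ 1 := by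
    have := mul_le_mul_of_nonneg_left (show Λ ≤ 1 + 16 * d + Λ by linarith) hθ0.le
    linarith [this, hθd]
  have hsmall : (d : ℝ) * δ ^ 2 * (4 * (K : ℝ)) ^ 2 ≤ 1 := by
    have e : (d : ℝ) * δ ^ 2 * (4 * (K : ℝ)) ^ 2 = 16 * d * ((K : ℝ) * δ) ^ 2 := by ring
    rw [e]
    have := mul_le_mul_of_nonneg_left hKδ2 (by positivity : (0 : ℝ) ≤ 16 * d)
    linarith
  have hslack : ((8 * A + 4) * (5 * d * δ ^ 2 * (4 * (K : ℝ)) ^ 2)) * (4 * (4 * (2 : ℝ) ^ d * A₀)) ^ d ≤ 4 * (2 : ℝ) ^ d * A₀ := by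
    have e : ((8 * A + 4) * (5 * d * δ ^ 2 * (4 * (K : ℝ)) ^ 2)) * (4 * (4 * (2 : ℝ) ^ d * A₀)) ^ d = Λ * ((K : ℝ) * δ) ^ 2 := by rw [hΛ]; ring
    rw [e]
    have h1 : Λ * ((K : ℝ) * δ) ^ 2 ≤ Λ * θ := mul_le_mul_of_nonneg_left hKδ2 hΛ0
    have h2 : Λ * θ ≤ 1 := hΛθ
    have h3 : (1 : ℝ) ≤ 4 * (2 : ℝ) ^ d * A₀ := by
      have : (1 : ℝ) ≤ (2 : ℝ) ^ d := one_le_pow₀ (by norm_num)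
      calc (1 : ℝ) ≤ 4 * 1 * 1 := by norm_num
        _ ≤ 4 * (2 : ℝ) ^ d * A₀ := by gcongr
    linarith
  -- the explicit estimate
  have hmain := covariant_interior_holder_explicit hd R hκ u g src a hK hMu hm hσ hδ hEq hu hg hs hR hsmall
    (by rw [← hA, ← hA₀]; exact hslack) hρ₀ hρ₀K hx'
  rw [← hA, ← hA₀, ← hCM] at hmain
  -- the substitution (bookkeeping lemma)
  set S : ℝ := Mu + (K : ℝ) * m + (K : ℝ) ^ 2 * σ with hS
  have hS0 : 0 ≤ S := by rw [hS]; positivity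
  have hA8 : 0 ≤ 8 * A + 4 := by linarith
  have hA16 : 0 ≤ 16 * A + 2 := by linarith
  have hsub := morrey_constant_le (d := d) (A := A) (CM := CM) hA8 hA16 hCM0 hMu hm hσ hδ hK0 (hKδ.trans hθ1)
  rw [← hC₁, ← hS] at hsub
  -- conclude
  have hfin : Real.sqrt ((2 * (CM * (126 * d * (7 : ℝ) ^ d * Mu ^ 2 / (K : ℝ)
              + (4 * d * (6 : ℝ) ^ d * m ^ 2 + 2 * (6 : ℝ) ^ d * (Mu * σ)
                 + (3 : ℝ) ^ d * ((2 : ℝ) ^ d * ((8 * A + 4) * (5 * (4 * d * m ^ 2 + (4 * (K : ℝ)) ^ 2 * σ ^ 2 + 5 * d * δ ^ 2 * Mu ^ 2))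
                    + (16 * A + 2) * (d * δ ^ 2 * Mu ^ 2)))) * (K : ℝ)))
          + 2 * d * (2 : ℝ) ^ d * (δ ^ 2 * (2 * (K : ℝ) + 1)) * Mu ^ 2) * (2 * (ρ₀ : ℝ) + 1))
      ≤ Real.sqrt C₁ * S * Real.sqrt ((2 * (ρ₀ : ℝ) + 1) / (K : ℝ)) := by
    have h1 := mul_le_mul_of_nonneg_right hsub (by positivity : (0 : ℝ) ≤ 2 * (ρ₀ : ℝ) + 1)
    have e : C₁ * S ^ 2 / K * (2 * (ρ₀ : ℝ) + 1) = (Real.sqrt C₁ * S * Real.sqrt ((2 * (ρ₀ : ℝ) + 1) / (K : ℝ))) ^ 2 := by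
      rw [mul_pow, mul_pow, Real.sq_sqrt hC₁0, Real.sq_sqrt (by positivity)]; field_simp
    rw [e] at h1
    exact (Real.sqrt_le_sqrt h1).trans (le_of_eq (Real.sqrt_sq (by positivity)))
  calc ‖u x' - u a‖ ≤ _ := hmain
    _ ≤ 17 * Real.sqrt (16 * d * 8 ^ d) * (Real.sqrt C₁ * S * Real.sqrt ((2 * (ρ₀ : ℝ) + 1) / (K : ℝ))) := mul_le_mul_of_nonneg_left hfin (by positivity)
    _ = 17 * Real.sqrt (16 * d * 8 ^ d) * Real.sqrt C₁ * (Mu + (K : ℝ) * m + (K : ℝ) ^ 2 * σ) * Real.sqrt ((2 * (ρ₀ : ℝ) + 1) / (K : ℝ)) := by rw [hS]; ring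

end Summit.QuantumFields.YangMills.Theorems.Prop7CovariantInteriorHolderZd

end
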